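import Mathlib
import HarnessLib

/-!
# Crux `PriceOfContractivity` (stmt-ValiantsHypothesis-10583), line `registered` (birth rev 10) —
# stub `piece3_trie` (the forest / trie determinant identity, "Lemma T", piece W4)

Route `ValiantsHypothesis/ContractivityPrice`, crux K1
(`Summit.ValiantsHypothesis.ValiantsHypothesis.Theses.ContractivityPrice.PriceOfContractivity`).
Piece W4 of the few-colours line (`stub_stableLifting_fewColours`): the abstract "trie
realisation of a sparse polynomial" as a determinant `det (1 + diagonal y * M)`.

DATA. A finite forest on `V`: `par w = some v` means `v` is the parent of `w`, `par w = none`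
means `w` is a root; `rk` strictly increases from parent to child (acyclicity). `y` is a variable
per node, `e` a weight per node, and `mon` the path monomial: `mon root = y root`,
`mon child = mon parent * y child`. MATRIX: `M v w = N₀ v w + e v * r w` with `N₀ v w = -1` iff
`v = par w` (else `0`) and `r w = 1` iff `w` is a root (else `0`).

CLAIM (`piece3_trie`). Over any commutative ring,
`det (1 + diagonal y * M) = 1 + ∑ w, e w * mon w`.

PROOF (division free, no recursion). Put `X := 1 + diagonal y * N₀`, `u := diagonal y *ᵥ e`
and let `s` be the "parent monomial": `s w = 1` for a root `w` and `s w = mon v` if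
`par w = some v`; the two hypotheses on `mon` say exactly `mon w = s w * y w`.
* `s ᵥ* X = r`: `(s ᵥ* X) w = s w - [par w = some v] s v * y v`, which is `1` for a root and
  `mon v - s v * y v = 0` for a child `w` of `v`.
* Hence the rank-one factorisation
  `1 + diagonal y * M = X + vecMulVec u r = X + vecMulVec u (s ᵥ* X) = (1 + vecMulVec u s) * X`.
* `det X = 1`: `X` is block triangular with respect to `rk` (an off-diagonal entry `(v, w)` of
  `X` is nonzero only if `par w = some v`, so `rk v < rk w`), and its diagonal blocks are identity
  matrices (`N₀` vanishes between two nodes of equal rank); `Matrix.BlockTriangular.det`.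
* `det (1 + vecMulVec u s) = 1 + s ⬝ᵥ u = 1 + ∑ w, s w * (y w * e w) = 1 + ∑ w, e w * mon w`
  (the matrix determinant lemma `Matrix.det_one_add_replicateCol_mul_replicateRow`).
-/

noncomputable section

-- `Summit.<Summit>.<Problem>` repeats `ValiantsHypothesis` by the tree's layout convention (D-0017).
set_option linter.dupNamespace false

namespace Summit.ValiantsHypothesis.ValiantsHypothesis.Theorems.PriceOfContractivity.FewColours

open Matrix

/-- Rank-one perturbations of the identity: `det (1 + u sᵀ) = 1 + s ⬝ᵥ u` (the matrix
determinant lemma at `A = 1`, stated for `Matrix.vecMulVec`). -/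
theorem det_one_add_vecMulVec {A : Type*} [CommRing A] {V : Type*} [Fintype V] [DecidableEq V]
    (u s : V → A) : (1 + vecMulVec u s).det = 1 + s ⬝ᵥ u := by
  rw [vecMulVec_eq Unit, det_one_add_replicateCol_mul_replicateRow]

/-- The unipotent part of the trie matrix has determinant one: if the off-diagonal support of
`N₀` only joins a parent row `v` to a child column `w` (`par w = some v`, so `rk v < rk w`), then
`det (1 + diagonal y * N₀) = 1` (block triangular with identity diagonal blocks). -/
theorem det_one_add_diagonal_mul_forest {A : Type*} [CommRing A] {V : Type*} [Fintype V]
    [DecidableEq V] (par : V → Option V) (rk : V → ℕ)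
    (hrk : ∀ v w, par w = some v → rk v < rk w) (y : V → A) :
    (1 + diagonal y * of (fun v w : V => if par w = some v then (-1 : A) else 0)).det = 1 := by
  set X : Matrix V V A :=
    1 + diagonal y * of (fun v w : V => if par w = some v then (-1 : A) else 0) with hX
  -- the entries of `X`
  have hXapply : ∀ v w, X v w =
      (if v = w then 1 else 0) + y v * (if par w = some v then -1 else 0) := by
    intro v w
    simp [hX, Matrix.add_apply, Matrix.one_apply]
  -- `X` is block triangular with respect to the rank
  have hBT : X.BlockTriangular rk := by
    intro v w hvw
    rw [hXapply]
    have hne : v ≠ w := fun h => by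
      subst h
      exact lt_irrefl _ hvw
    have hpar : par w ≠ some v := fun h => lt_asymm (hrk v w h) hvw
    simp [hne, hpar]
  rw [hBT.det]
  refine Finset.prod_eq_one fun a _ => ?_
  -- every diagonal block is an identity matrix
  have hblock : X.toSquareBlock rk a = 1 := by
    ext ⟨v, hv⟩ ⟨w, hw⟩
    have hpar : par w ≠ some v := fun h => by
      have h' := hrk v w h
      rw [hv, hw] at h'
      exact lt_irrefl _ h'
    simp only [toSquareBlock_def, of_apply, hXapply, Matrix.one_apply, Subtype.mk.injEq]
    simp [hpar]
  rw [hblock, det_one]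

/-- **Lemma T (trie realisation), abstract form.** For a finite forest `par` on `V` (acyclic via
the strictly increasing rank `rk`), node variables `y`, node weights `e` and path monomials `mon`
(`mon root = y root`, `mon child = mon parent * y child`), over any commutative ring
`det (1 + diagonal y * (N₀ + e rᵀ)) = 1 + ∑ w, e w * mon w`, where `N₀ v w = -1` iff `v` is the
parent of `w` (else `0`) and `r` is the indicator of the roots. -/
theorem piece3_trie :
    ∀ {A : Type} [CommRing A] {V : Type} [Fintype V] [DecidableEq V] (par : V → Option V) (rk : V → ℕ),
      (∀ v w, par w = some v → rk v < rk w) →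
      ∀ (y e mon : V → A), (∀ w, par w = none → mon w = y w) →
        (∀ v w, par w = some v → mon w = mon v * y w) →
        (1 + Matrix.diagonal y *
            Matrix.of (fun v w : V => (if par w = some v then (-1 : A) else 0) +
              e v * (if par w = none then 1 else 0))).det =
          1 + ∑ w, e w * mon w := by
  intro A _ V _ _ par rk hrk y e mon hroot hchild
  -- the nilpotent part `N₀`, the unipotent factor `X`, the root indicator `r`,
  -- the parent monomial `s`
  set N₀ : Matrix V V A := of (fun v w : V => if par w = some v then (-1 : A) else 0) with hN₀
  set X : Matrix V V A := 1 + diagonal y * N₀ with hX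
  set r : V → A := fun w => if par w = none then 1 else 0 with hr
  set s : V → A := fun w => (par w).elim 1 mon with hs
  -- `mon w = s w * y w`
  have hmon : ∀ w, mon w = s w * y w := by
    intro w
    rcases hpw : par w with _ | v
    · simp [hs, hpw, hroot w hpw]
    · simp [hs, hpw, hchild v w hpw]
  -- the entries of `X`
  have hXapply : ∀ v w, X v w =
      (if v = w then 1 else 0) + y v * (if par w = some v then -1 else 0) := by
    intro v w
    simp [hX, hN₀, Matrix.add_apply, Matrix.one_apply]
  -- `s ᵥ* X = r`
  have hsX : s ᵥ* X = r := by
    ext w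
    simp only [vecMul, dotProduct, hXapply, mul_add, Finset.sum_add_distrib, hr]
    rcases hpw : par w with _ | v
    · simp [hs, hpw]
    · have hsw : s w = mon v := by simp [hs, hpw]
      simp [Finset.sum_ite_eq', hsw, hmon v]
  -- the matrix `M = N₀ + e rᵀ`
  have hM : of (fun v w : V => (if par w = some v then (-1 : A) else 0) +
      e v * (if par w = none then 1 else 0)) = N₀ + vecMulVec e r := by
    ext v w
    rfl
  -- the rank-one factorisation `1 + diagonal y * M = (1 + u sᵀ) * X`
  have hfac : 1 + diagonal y * of (fun v w : V => (if par w = some v then (-1 : A) else 0) +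
      e v * (if par w = none then 1 else 0)) = (1 + vecMulVec (diagonal y *ᵥ e) s) * X := by
    rw [hM, mul_add, mul_vecMulVec, add_mul, one_mul, vecMulVec_mul, hsX, hX, add_assoc]
  have hdetX : X.det = 1 := det_one_add_diagonal_mul_forest par rk hrk y
  rw [hfac, det_mul, hdetX, mul_one, det_one_add_vecMulVec]
  congr 1
  simp only [dotProduct, mulVec_diagonal]
  exact Finset.sum_congr rfl fun w _ => by rw [hmon w]; ring
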